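import Summits.CriticalPhenomena.PercolationContinuityZ3.Theorems.PercNearOneGluingNoHeavyRsw3AnnulusTwoArmCritical
import HarnessLib

/-!
# RSW3 lane (P2, gen 10): a same-`p` SUPERCRITICALITY criterion for `ℤ³` in the lane's vocabulary — near-certain aspect-2
# sponge crossing + near-certain aspect-2 uniqueness zone at ONE scale `N ≥ 10` imply `θ(p) > 0`

builds on p205010 (kernel theorem, internal audit signed; external expert review pending)

Cell `prim-rsw3`, prover seat `prim-rsw3-p2` (gen 10), memo `run/shared/lean/prim/rsw3/P2-RSWLITE.md` §16.
Support file (`--supports stmt-CriticalPhenomena-4575`); no definitions, no named facts, no sorries.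

`theta_pos_of_sponge_uniqZone` (EVERY `p`, every `N ≥ 10`; `η = δ^{441}/2`, `δ = 1/(2·((20+1)²+2)·(2·(3²+1)²)^{(20+1)²})`):

  `P_p((boxCross (easyShape 2 (2N)) 0)ᶜ) ≤ η^{100}`  and  `P_p((uniqZone N (2N))ᶜ) ≤ η`   ⟹   `θ(p) > 0`.

I.e. Aizenman's 1997 criterion (ii) ("`[1 - R] + D` too small ⇒ percolation") at ASPECT 2 for bond percolation on `ℤ³`, with the
sponge block `{0..2N} × {0..4N}²` as the crossing input and the uniqueness zone of `Λ(2N) ∖ Λ(N)` as the regularity input: the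
square-root trick localises the sponge crossing to a patch of side `⌊(N-1)/2⌋` (`real_compl_cross_le_rpow`) and the localised-source
renormalisation `theta_pos_of_src_uniqZone_criterion` does the rest.  The contrapositive at `p ≤ p_c` (`θ = 0`), combined with the
sponge dichotomy, is how `annulusTwoArmLowerBound` was proved; here the criterion is recorded on its own, as the supercritical companion
of the lane's subcriticality criteria (gen 2 `lt_criticalProb_iff_exists_real_boxCrossing_lt`, gen 9
`lt_criticalProb_iff_exists_real_boxCross_easyShape_three_lt`).  Also `real_compl_boxCross_or_compl_uniqZone_of_le_criticalProb`:
for `p ≤ p_c(ℤ³)` and every `N ≥ 10`, one of the two defects exceeds its threshold.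

HONEST PLACEMENT.  Bookkeeping over the gen-10 files; thresholds explicit and astronomically small; the converse ("for `p > p_c` both
defects tend to `0`") is Grimmett–Marstrand-type finite-box uniqueness and is NOT claimed.

References: M. Aizenman, Nucl. Phys. B 485 (1997), §2 criterion (ii) [Aizenman1997]; S. Martineau, V. Tassion, Ann. Probab. 45 (2017),
§3 [MartineauTassion2017]; G. Grimmett, *Percolation* (1999), §7.4 [GrimmettPercolation1999]. [folklore]
-/

noncomputable section

namespace Summit.CriticalPhenomena.PercolationContinuityZ3.Theorems.Rsw3

open MeasureTheory Literature.Probability.LatticeModels Literature.Probability.Percolation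
open Literature.Probability.Percolation.KestenZhang Literature.Probability.Percolation.KozmaNitzan SimpleGraph Relation
open Summit.CriticalPhenomena.PercolationContinuityZ3.Theorems.Crossing SurfaceTension

/-- **Same-`p` supercriticality criterion at aspect 2** (bond percolation on `ℤ³`, ANY `p`, any `N ≥ 10`): with
`δ = 1/(2·((20+1)²+2)·(2·(3²+1)²)^{(20+1)²})` and `η = δ^{(20+1)²}/2`, if the aspect-2 sponge block `{0..2N} × {0..4N}²` fails to be
crossed the thin way with probability `≤ η^{100}` and the uniqueness zone of `Λ(2N) ∖ Λ(N)` fails with probability `≤ η`, then `θ(p) > 0`.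
[cite: Aizenman1997, §2 criterion (ii)] [cite: MartineauTassion2017, §3.3] -/
theorem theta_pos_of_sponge_uniqZone (p : unitInterval) {N : ℕ} (hN : 10 ≤ N)
    (hsponge : (bondPercolation (zdGraph 3) p).real (boxCross (easyShape 2 (2 * N)) 0)ᶜ ≤
      ((1 / (2 * ((20 + 1) ^ 2 + 2 : ℝ) * (2 * (3 ^ 2 + 1 : ℝ) ^ 2) ^ ((20 + 1) ^ 2))) ^ ((20 + 1) ^ 2) / 2) ^ 100)
    (huniq : (bondPercolation (zdGraph 3) p).real (uniqZone (d := 3) N (2 * N))ᶜ ≤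
      (1 / (2 * ((20 + 1) ^ 2 + 2 : ℝ) * (2 * (3 ^ 2 + 1 : ℝ) ^ 2) ^ ((20 + 1) ^ 2))) ^ ((20 + 1) ^ 2) / 2) :
    0 < theta (zdGraph 3) (0 : Site 3) p := by
  classical
  set μ := bondPercolation (zdGraph 3) p with hμ
  set δ : ℝ := 1 / (2 * ((20 + 1) ^ 2 + 2 : ℝ) * (2 * (3 ^ 2 + 1 : ℝ) ^ 2) ^ ((20 + 1) ^ 2)) with hδ
  set η : ℝ := δ ^ ((20 + 1) ^ 2) / 2 with hη
  have hδpos : 0 < δ := by rw [hδ]; positivity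
  have hηpos : 0 < η := by rw [hη]; positivity
  set m : ℕ := (N - 1) / 2 with hm
  have hm1 : 2 * m + 1 ≤ N := by omega
  have hm2 : N ≤ 2 * m + 2 := by omega
  -- the localised crossing fails with probability `≤ (η^100)^{1/100} = η`
  have hcross := real_compl_cross_le_rpow p hN
  rw [← hm, ← hμ] at hcross
  have hrpow : (μ.real (boxCross (easyShape 2 (2 * N)) 0)ᶜ) ^ (((10 : ℝ) ^ 2)⁻¹) ≤ η := by
    have h1 : (μ.real (boxCross (easyShape 2 (2 * N)) 0)ᶜ) ^ (((10 : ℝ) ^ 2)⁻¹) ≤ (η ^ 100) ^ (((10 : ℝ) ^ 2)⁻¹) :=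
      Real.rpow_le_rpow measureReal_nonneg hsponge (by positivity)
    have h2 : (η ^ 100) ^ (((10 : ℝ) ^ 2)⁻¹) = η := by
      rw [show ((10 : ℝ) ^ 2)⁻¹ = ((100 : ℕ) : ℝ)⁻¹ by norm_num]
      exact Real.pow_rpow_inv_natCast hηpos.le (by norm_num)
    exact h1.trans h2.le
  have hsum : μ.real
        (linked
          (↑(Finset.Icc (![(0 : ℤ), -(9 * (m : ℤ)), -(9 * (m : ℤ))] : Site 3) ![2 * (N : ℤ), 10 * (m : ℤ), 10 * (m : ℤ)]))
          (↑(Finset.Icc (0 : Site 3) ![((0 : ℕ) : ℤ), m, m]))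
          (↑(Finset.Icc (![2 * (N : ℤ), -(9 * (m : ℤ)), -(9 * (m : ℤ))] : Site 3)
            ![2 * (N : ℤ), 10 * (m : ℤ), 10 * (m : ℤ)])))ᶜ +
        μ.real (uniqZone (d := 3) N (2 * N))ᶜ ≤ δ ^ ((20 + 1) ^ 2) := by
    have : η + η = δ ^ ((20 + 1) ^ 2) := by rw [hη]; exact add_halves _
    exact (add_le_add (hcross.trans hrpow) huniq).trans this.le
  exact theta_pos_of_src_uniqZone_criterion p hm1 hm2 hsum

/-- **At or below `p_c(ℤ³)` one of the two defects is seen at EVERY scale `N ≥ 10`:** for `p ≤ p_c` (so `θ(p) = 0`, p205010 and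
monotonicity), either the sponge block `{0..2N} × {0..4N}²` fails to be crossed with probability `> η^{100}`, or the uniqueness zone of
`Λ(2N) ∖ Λ(N)` fails with probability `> η`.  (At `p = p_c` the sponge dichotomy decides for the second alternative in the quantitative form
`annulusTwoArmLowerBound`.)
builds on p205010 (kernel theorem, internal audit signed; external expert review pending). [cite: Aizenman1997, §2 (criterion (ii) at p ≤ p_c)] -/
theorem real_compl_boxCross_or_compl_uniqZone_of_le_criticalProb (p : unitInterval) (hp : p ≤ criticalProbI 3) {N : ℕ} (hN : 10 ≤ N) :
    ((1 / (2 * ((20 + 1) ^ 2 + 2 : ℝ) * (2 * (3 ^ 2 + 1 : ℝ) ^ 2) ^ ((20 + 1) ^ 2))) ^ ((20 + 1) ^ 2) / 2) ^ 100 <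
        (bondPercolation (zdGraph 3) p).real (boxCross (easyShape 2 (2 * N)) 0)ᶜ ∨
      (1 / (2 * ((20 + 1) ^ 2 + 2 : ℝ) * (2 * (3 ^ 2 + 1 : ℝ) ^ 2) ^ ((20 + 1) ^ 2))) ^ ((20 + 1) ^ 2) / 2 <
        (bondPercolation (zdGraph 3) p).real (uniqZone (d := 3) N (2 * N))ᶜ := by
  by_contra h
  push Not at h
  have hθ : 0 < theta (zdGraph 3) (0 : Site 3) p := theta_pos_of_sponge_uniqZone p hN h.1 h.2
  have h0 : theta (zdGraph 3) (0 : Site 3) (criticalProbI 3) = 0 := CSH.percolationContinuity_allDimensions 3 (by norm_num)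
  have hmono : theta (zdGraph 3) (0 : Site 3) p ≤ theta (zdGraph 3) (0 : Site 3) (criticalProbI 3) :=
    theta_mono_holds (zdGraph 3) (0 : Site 3) hp
  linarith
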